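import Literature.Geometry.Riemannian.CanonicalNeighbourhoodTheorem
import Literature.Geometry.Riemannian.RicciFlowScalarCurvatureRegularity
import Literature.Geometry.Lorentzian.CurvatureRegularity
import Mathlib.Geometry.Manifold.ContMDiffMFDeriv
import HarnessLib

/-!
# The curvature of a smooth family of metrics is smooth jointly in space and time
(topic `Geometry/Riemannian`; discharge of the named fact `continuousOn_scalarCurvatureWith_family`)

Parametric companion of `Lorentzian/CurvatureRegularity.lean` (one metric: `R`, `Ric`, `S` are
`C^∞` in `x`) and of `RicciFlowScalarCurvatureRegularity.lean` (along a *Ricci flow* on `[0, T]`,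
`R(x, t)` is `C^∞` on space-time, by the flow equation `Ric = -½ ∂ₜg`). Here no evolution equation
is assumed: for an ARBITRARY one-parameter family `g` of `C^∞` pseudo-Riemannian metrics that is
`C^∞` on `M × S` in the sense of `IsContMDiffFamilyOn` (`RicciFlow.lean`; within `S` in time,
hence one-sided at `t = 0` for `S = [0, T)`) and arbitrary Levi-Civita witnesses `cov t`
(torsion-free, `g t`-compatible; `t ∈ S`), the Christoffel data, the curvature tensor, the Ricci
tensor and the scalar curvature of `(g t, cov t)` are `C^∞` jointly in `(x, t)` on `M × S`. This is
the content of the standing convention of the Ricci-flow literature — Topping 2006, §1.2.3: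
"`g(t)` is a smooth family of smooth metrics – smooth all the way to `t = 0` and `t = T`", under
which every curvature quantity is smooth on space-time — combined with the classical fact that in a
chart the curvature is a universal rational expression in the metric coefficients and their
derivatives up to order two (Gallot–Hulin–Lafontaine 2004, Prop. 2.54: `Γ^i_{jk} = ½ g^{il}(∂_j
g_{kl} + ∂_k g_{lj} - ∂_l g_{jk})`; 3.A.3: `R` in terms of `∂Γ + ΓΓ`; O'Neill 1983, Def. 3.53:
`S = C(Ric) ∈ 𝔉(M)`). It discharges the regularity fact
`Literature.Geometry.Riemannian.continuousOn_scalarCurvatureWith_family`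
(`CanonicalNeighbourhoodTheorem.lean`, used there for the boundedness of `R` on `M × [0, t₁]`,
`t₁ < T`, in the reduction of Chen–Zhu's a priori assumptions), in the stronger `C^∞` form.

## The argument (all proved; `e` = the trivialization of `TM` at `x₀`, frame `X_v : y ↦ e.symmL y v`)

* `contMDiffOn_mvfderiv_slice` — **space derivatives of a jointly smooth scalar function along
  the frame are jointly smooth**: for `F` `C^∞` on `a × S` (`a ⊆ e.baseSet` open),
  `(x, t) ↦ d(F(·,t))_x (X_v x)` is `C^∞` on `a × S`. This is Mathlib's
  `ContMDiffWithinAt.mfderivWithin_apply` (smooth dependence of partial derivatives on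
  parameters), unwound from the tangent coordinates at the point considered.
* `IsContMDiffFamilyOn.contMDiffOn_gramOp`, `…_gramOp_inverse` — the Gram operator
  `G(x,t) v w = g_t(x)(X_v, X_w)` and its inverse are jointly `C^∞` (metric coefficients by
  `IsContMDiffFamilyOn.contMDiffOn_val_apply` of `RicciFlowScalarCurvatureRegularity.lean`;
  inversion by `ContinuousLinearMap.IsInvertible.contDiffAt_map_inverse`).
* `IsContMDiffFamilyOn.contMDiffOn_koszulFunctional_symmL`, `…_christoffelCoord` — the Koszul
  functional `K_t(X_v, X_u, X_w)(x)` on frame fields is jointly `C^∞`, hence, by the Koszul formula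
  for the torsion-free compatible `cov t` (`IsLeviCivita.two_mul_val_apply_eq_koszulFunctional`,
  `LeviCivitaProofs.lean`) and `G⁻¹`, so are the coordinates `e_x(∇^t_{X_v} X_u (x))`
  (Gallot–Hulin–Lafontaine 2004, Prop. 2.54, with parameters).
* `cov_sum_smul_eq`, `IsContMDiffFamilyOn.contMDiffOn_secondCovDerivCoord`,
  `…_covBracketCoord`, `…_curvatureCoord` — second covariant derivatives of the frame (expand
  `∇_{X_u} X_{u'} = ∑ cᵢ X_{bᵢ}` near `x`, then locality, additivity and the Leibniz rule of
  `∇^t`), the bracket term `∇_{[X_v, X_u]} X_{u'}`, and so the curvature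
  `e_x(R^t_x(X_v, X_u)X_{u'})` (`CovariantDerivative.curvature_apply_of_isLocallyContMDiff`,
  `cov t` being locally `C¹`, `IsLeviCivita.isLocallyContMDiff_one`) are jointly `C^∞`
  (Gallot–Hulin–Lafontaine 2004, 3.A.3, with parameters).
* `IsContMDiffFamilyOn.contMDiffOn_ricci_symmL`, `…_ricci_apply_of_section`,
  `…_scalarCurvatureWith_baseSet` — the Ricci tensor (trace in the frame basis) on frame fields
  and on arbitrary `C^∞` fields, and the scalar curvature
  `R = ∑ᵢⱼ (G⁻¹)ⱼᵢ Ric(X_{bᵢ}, X_{bⱼ})` (`trace_eq_sum_gram_inv`, inverse Gram matrix by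
  `contMDiffWithinAt_matrix_inv`), jointly `C^∞` on `e.baseSet × S`.
* **`IsContMDiffFamilyOn.contMDiffOn_scalarCurvatureWith`** — `(x, t) ↦ R(x, t)` is `C^∞` on
  `M × S`; `IsContMDiffFamilyOn.continuousOn_scalarCurvatureWith` — hence continuous; and the
  discharge **`continuousOn_scalarCurvatureWith_family_holds`** (the hypothesis `I.Boundaryless`
  of the fact is not used).

## Design notes

* Everything is local in `x` and uses only the trivialization of `TM` at a point and its frame
  `y ↦ e.symmL y v` (as in `contMDiffAt_inCoordinates_leviCivita`, `LeviCivitaProofs.lean`); no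
  charts of `M` are opened explicitly. Smoothness "on `M × S`" is `ContMDiffOn` on the product
  manifold `M × ℝ` within `univ ×ˢ S`, exactly the encoding of `IsContMDiffFamilyOn` and of the
  weak maximum principle of `RicciFlowScalarMaximumPrinciple.lean`.
* Only `C^∞` is treated. No signature, compactness or boundarylessness hypothesis is needed.

## References

* [Topping2006] P. Topping, *Lectures on the Ricci flow*, LMS Lecture Note Series 325, Cambridge
  Univ. Press 2006, §1.2.3 (smoothness convention on space-time).
* [GallotHulinLafontaine2004] S. Gallot, D. Hulin, J. Lafontaine, *Riemannian Geometry*, 3rd ed.,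
  Springer 2004, Prop. 2.54 (p. 70: Christoffel symbols in coordinates), 3.A.3 (p. 108: curvature
  in coordinates).
* [ONeill1983] B. O'Neill, *Semi-Riemannian geometry with applications to relativity*, Academic
  Press 1983, Ch. 3, Lemma 3.35 (`R` is a tensor field), Def. 3.51 (`Ric`), Def. 3.53
  (`S = C(Ric) ∈ 𝔉(M)`), pp. 60–61 (metric contraction in a frame).
-/

noncomputable section

open Bundle Set NormedSpace FiberBundle VectorField Matrix Function
open scoped Manifold ContDiff Topology BigOperators

namespace Literature.Geometry.Riemannian

open Lorentzian Lorentzian.PseudoRiemannianMetric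


/-! ### Slices of functions on space-time -/

section Evaluation

variable {E : Type*} [NormedAddCommGroup E] [NormedSpace ℝ E] {H : Type*} [TopologicalSpace H]
  {I : ModelWithCorners ℝ E H} {M : Type*} [TopologicalSpace M] [ChartedSpace H M]
  {k : ℕ∞ω} {S : Set ℝ}

/-- Slicing a function `C^k` on `a × S` at a time `t ∈ S`: `y ↦ F (y, t)` is `C^k` on `a`.
[folklore] -/
theorem contMDiffOn_slice {F' : Type*} [NormedAddCommGroup F'] [NormedSpace ℝ F']
    {F : M × ℝ → F'} {a : Set M} (hF : ContMDiffOn (I.prod 𝓘(ℝ, ℝ)) 𝓘(ℝ, F') k F (a ×ˢ S))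
    {t : ℝ} (ht : t ∈ S) : CMDiff[a] k (fun y ↦ F (y, t)) :=
  hF.comp (contMDiffOn_id.prodMk contMDiffOn_const) fun _ hy ↦ ⟨hy, ht⟩

end Evaluation

/-! ### Space derivatives of jointly smooth functions along the frame of a trivialization -/

section SliceDerivative

variable {E : Type*} [NormedAddCommGroup E] [NormedSpace ℝ E] {H : Type*} [TopologicalSpace H]
  {I : ModelWithCorners ℝ E H} {M : Type*} [TopologicalSpace M] [ChartedSpace H M]
  [IsManifold I ∞ M]

/-- **Space derivatives of a jointly smooth function are jointly smooth.** Let `F : M × ℝ → ℝ` be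
`C^∞` on `a × S` (within, on the product manifold), `a` open and contained in the base set of the
trivialization `e` of `TM` at `x₀`, and `v ∈ E`. Then the derivative of the slice `y ↦ F (y, t)` at
`x` in the direction of the frame vector `e.symmL x v ∈ T_x M`,
`(x, t) ↦ d(F(·, t))_x (e.symmL x v)`, is again `C^∞` on `a × S`. This is Mathlib's
`ContMDiffWithinAt.mfderivWithin_apply` (smooth dependence of partial derivatives on parameters,
stated there in the coordinates of the trivialization at the base point), unwound: at a point
`p = (x, t)` the coordinates are those of the trivialization at `x`, and the frame vector
`e.symmL y v` is fed in through its (smooth) coordinates there. In charts this is the statement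
that `∂ₖ F(z, t)` is smooth in `(z, t)` when `F` is. [folklore] -/
theorem contMDiffOn_mvfderiv_slice (x₀ : M) {a : Set M} (ha : IsOpen a)
    (hae : a ⊆ (trivializationAt E (TangentSpace I : M → Type _) x₀).baseSet) {S : Set ℝ}
    {F : M × ℝ → ℝ} (hF : ContMDiffOn (I.prod 𝓘(ℝ, ℝ)) 𝓘(ℝ, ℝ) ∞ F (a ×ˢ S)) (v : E) :
    ContMDiffOn (I.prod 𝓘(ℝ, ℝ)) 𝓘(ℝ, ℝ) ∞
      (fun p : M × ℝ ↦ mvfderiv I (fun y ↦ F (y, p.2)) p.1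
        ((trivializationAt E (TangentSpace I : M → Type _) x₀).symmL ℝ p.1 v)) (a ×ˢ S) := by
  intro p hp
  set e := trivializationAt E (TangentSpace I : M → Type _) x₀ with he
  set e' := trivializationAt E (TangentSpace I : M → Type _) p.1 with he'
  have hp1 : p.1 ∈ e'.baseSet := mem_baseSet_trivializationAt E (TangentSpace I : M → Type _) p.1
  -- the family `f q = F (·, q.2)` of functions of `y ∈ M`, parametrized by `q ∈ M × ℝ`
  set f : M × ℝ → M → ℝ := fun q y ↦ F (y, q.2) with hf_def
  have hf : CMDiffAt[(a ×ˢ S) ×ˢ a] ∞ (Function.uncurry f) (p, p.1) := by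
    have hψ : ContMDiffWithinAt ((I.prod 𝓘(ℝ, ℝ)).prod I) (I.prod 𝓘(ℝ, ℝ)) ∞
        (fun r : (M × ℝ) × M ↦ ((r.2, r.1.2) : M × ℝ)) ((a ×ˢ S) ×ˢ a) (p, p.1) :=
      contMDiffWithinAt_snd.prodMk contMDiffWithinAt_fst.snd
    have hFp : ContMDiffWithinAt (I.prod 𝓘(ℝ, ℝ)) 𝓘(ℝ, ℝ) ∞ F (a ×ˢ S)
        ((fun r : (M × ℝ) × M ↦ ((r.2, r.1.2) : M × ℝ)) (p, p.1)) := hF p hp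
    refine hFp.comp (p, p.1) hψ fun r hr ↦ ?_
    simp only [mem_prod] at hr ⊢
    exact ⟨hr.2, hr.1.2⟩
  -- the frame vector `e.symmL y v`, read in the trivialization at `p.1`
  set g₂ : M × ℝ → E := fun q ↦ e'.continuousLinearMapAt ℝ q.1 (e.symmL ℝ q.1 v) with hg₂_def
  have hsec : CMDiffAt ∞ (T% (fun y : M ↦ e.symmL ℝ y v)) p.1 := by
    have h : CMDiff[e.baseSet] ∞ (T% (fun y : M ↦ e.symmL ℝ y v)) := by
      rw [e.contMDiffOn_section_baseSet_iff]
      apply (contMDiffOn_const (c := v)).congr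
      intro y hy
      rw [← Trivialization.continuousLinearMapAt_apply_of_mem (R := ℝ) _ hy,
        Trivialization.continuousLinearMapAt_symmL _ hy]
    exact (h p.1 (hae hp.1)).contMDiffAt (e.open_baseSet.mem_nhds (hae hp.1))
  have hg₂ : CMDiffAt[a ×ˢ S] ∞ g₂ p := by
    have h1 : CMDiffAt ∞ (fun y : M ↦ (e' ⟨y, e.symmL ℝ y v⟩).2) p.1 := by
      rw [contMDiffAt_section] at hsec
      exact hsec
    have h2 : CMDiffAt ∞ (fun y : M ↦ e'.continuousLinearMapAt ℝ y (e.symmL ℝ y v)) p.1 := by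
      refine h1.congr_of_eventuallyEq ?_
      filter_upwards [e'.open_baseSet.mem_nhds hp1] with y hy
      exact Trivialization.continuousLinearMapAt_apply_of_mem (R := ℝ) e' hy _
    have hfst : ContMDiffWithinAt (I.prod 𝓘(ℝ, ℝ)) I ∞ (Prod.fst : M × ℝ → M) (a ×ˢ S) p :=
      contMDiffWithinAt_fst
    exact h2.comp_contMDiffWithinAt p hfst
  have hmn : (∞ : ℕ∞ω) + 1 ≤ ∞ := le_rfl
  have key := ContMDiffWithinAt.mfderivWithin_apply (I := I) (I' := 𝓘(ℝ, ℝ))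
    (J := I.prod 𝓘(ℝ, ℝ)) (J' := I.prod 𝓘(ℝ, ℝ)) (M' := ℝ) (g := Prod.fst)
    (g₁ := id) (x₀ := p) hf contMDiffWithinAt_fst contMDiffWithinAt_id hg₂ hmn (mapsTo_id _) hp
    (fun q hq ↦ hq.1) ha.uniqueMDiffOn
  refine key.congr_of_eventuallyEq_of_mem ?_ hp
  -- unwinding the coordinates near `p`
  have hnhds : ∀ᶠ q in 𝓝[a ×ˢ S] p, q ∈ a ×ˢ S ∧ q.1 ∈ e'.baseSet := by
    refine Filter.eventually_of_mem (Filter.inter_mem self_mem_nhdsWithin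
      (mem_nhdsWithin_of_mem_nhds
        ((e'.open_baseSet.preimage continuous_fst).mem_nhds (by exact hp1))))
      fun q hq ↦ ⟨hq.1, hq.2⟩
  filter_upwards [hnhds] with q hq
  obtain ⟨hqa, hq1⟩ := hq
  simp only [inTangentCoordinates, ContinuousLinearMap.inCoordinates, id_eq,
    TangentBundle.continuousLinearMapAt_model_space, ContinuousLinearMap.one_def,
    ContinuousLinearMap.coe_comp, Function.comp_apply, hg₂_def,
    ← he', e'.symmL_continuousLinearMapAt hq1]
  rw [mfderivWithin_of_isOpen ha hqa.1]
  rfl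

end SliceDerivative

/-! ### The frame of a trivialization: Gram operator, brackets, Koszul formula, Christoffel data -/

section Frame

variable {E : Type*} [NormedAddCommGroup E] [NormedSpace ℝ E] {H : Type*} [TopologicalSpace H]
  {I : ModelWithCorners ℝ E H} {M : Type*} [TopologicalSpace M] [ChartedSpace H M]
  [IsManifold I ∞ M] (x₀ : M)

/-- The frame fields `y ↦ e.symmL y v` of the trivialization `e` of `TM` at `x₀` are `C^∞` on its
base set (they are constant in the trivialization). [folklore] -/
theorem contMDiffOn_symmL_baseSet (v : E) :
    CMDiff[(trivializationAt E (TangentSpace I : M → Type _) x₀).baseSet] ∞ (T% (fun y : M ↦ (trivializationAt E (TangentSpace I : M → Type _) x₀).symmL ℝ y v)) := by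
  rw [(trivializationAt E (TangentSpace I : M → Type _) x₀).contMDiffOn_section_baseSet_iff]
  apply (contMDiffOn_const (c := v)).congr
  intro y hy
  rw [← Trivialization.continuousLinearMapAt_apply_of_mem (R := ℝ) _ hy,
    Trivialization.continuousLinearMapAt_symmL _ hy]

/-- The frame fields of a trivialization are `C^∞` at every point of the base set. [folklore] -/
theorem contMDiffAt_symmL (v : E) {y : M} (hy : y ∈ (trivializationAt E (TangentSpace I : M → Type _) x₀).baseSet) :
    CMDiffAt ∞ (T% (fun y : M ↦ (trivializationAt E (TangentSpace I : M → Type _) x₀).symmL ℝ y v)) y :=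
  (contMDiffOn_symmL_baseSet x₀ v y hy).contMDiffAt ((trivializationAt E (TangentSpace I : M → Type _) x₀).open_baseSet.mem_nhds hy)

/-- The frame fields of a trivialization are differentiable at every point of the base set.
[folklore] -/
theorem mdifferentiableAt_symmL (v : E) {y : M} (hy : y ∈ (trivializationAt E (TangentSpace I : M → Type _) x₀).baseSet) :
    MDiffAt (T% (fun y : M ↦ (trivializationAt E (TangentSpace I : M → Type _) x₀).symmL ℝ y v)) y :=
  (contMDiffAt_symmL x₀ v hy).mdifferentiableAt (by simp)

variable [CompleteSpace E]

/-- The Lie bracket of two frame fields of a trivialization is `C^∞` on the base set (Mathlib's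
`ContMDiffAt.mlieBracket_vectorField`). [folklore] -/
theorem contMDiffOn_mlieBracket_symmL (v w : E) :
    CMDiff[(trivializationAt E (TangentSpace I : M → Type _) x₀).baseSet] ∞ (T% (mlieBracket I (fun y : M ↦ (trivializationAt E (TangentSpace I : M → Type _) x₀).symmL ℝ y v)
      (fun y : M ↦ (trivializationAt E (TangentSpace I : M → Type _) x₀).symmL ℝ y w))) := by
  intro y hy
  haveI : IsManifold I (((⊤ : ℕ∞) : ℕ∞ω) + 1) M := by
    rw [show (((⊤ : ℕ∞) : ℕ∞ω)) + 1 = ∞ by rfl]; infer_instance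
  haveI : IsManifold I (minSmoothness ℝ 2) M := by
    rw [minSmoothness_of_isRCLikeNormedField]; infer_instance
  haveI : IsManifold I (minSmoothness ℝ 3) M := by
    rw [minSmoothness_of_isRCLikeNormedField]; infer_instance
  have hv : CMDiffAt ((⊤ : ℕ∞) : ℕ∞ω) (T% (fun y : M ↦ (trivializationAt E (TangentSpace I : M → Type _) x₀).symmL ℝ y v)) y :=
    contMDiffAt_symmL x₀ v hy
  have hw : CMDiffAt ((⊤ : ℕ∞) : ℕ∞ω) (T% (fun y : M ↦ (trivializationAt E (TangentSpace I : M → Type _) x₀).symmL ℝ y w)) y :=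
    contMDiffAt_symmL x₀ w hy
  exact (hv.mlieBracket_vectorField hw (m := ⊤) (by simp)).contMDiffWithinAt

variable [FiniteDimensional ℝ E]
  {g : ℝ → PseudoRiemannianMetric I ∞ E (TangentSpace I : M → Type _)} {S : Set ℝ}

omit [CompleteSpace E] in
/-- **The Gram operator of a smooth family in the frame of a trivialization is jointly smooth.**
For a family `g` that is `C^∞` on `M × S` and the trivialization `e` of `TM` at `x₀`, the map
`(x, t) ↦ G(x, t)`, `G(x, t) v w = g_t(x)(e.symmL x v, e.symmL x w)` — the Gram matrix
`g_{ij}(x, t)` of the frame, as an operator `E →L (E →L ℝ)` — is `C^∞` on `e.baseSet × S`.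
(Gallot–Hulin–Lafontaine 2004, Prop. 2.54: the Christoffel symbols are computed from the
`g_{ij}` and the inverse matrix `g^{ij}`.) [cite: GallotHulinLafontaine2004, Prop. 2.54 (p. 70)] -/
theorem IsContMDiffFamilyOn.contMDiffOn_gramOp (hg : IsContMDiffFamilyOn ∞ g S) :
    ContMDiffOn (I.prod 𝓘(ℝ, ℝ)) 𝓘(ℝ, E →L[ℝ] E →L[ℝ] ℝ) ∞
      (fun p : M × ℝ ↦ ContinuousLinearMap.bilinearComp
        (show E →L[ℝ] E →L[ℝ] ℝ from (g p.2).val p.1)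
        (show E →L[ℝ] E from (trivializationAt E (TangentSpace I : M → Type _) x₀).symmL ℝ p.1) (show E →L[ℝ] E from (trivializationAt E (TangentSpace I : M → Type _) x₀).symmL ℝ p.1))
      ((trivializationAt E (TangentSpace I : M → Type _) x₀).baseSet ×ˢ S) := by
  intro p hp
  rw [contMDiffWithinAt_clm_apply_iff]
  intro v
  rw [contMDiffWithinAt_clm_apply_iff]
  intro w
  exact hg.contMDiffOn_val_apply (contMDiffOn_symmL_baseSet x₀ v)
    (contMDiffOn_symmL_baseSet x₀ w) p hp

/-- **The inverse Gram operator `g^{ij}(x, t)` of a smooth family is jointly smooth** on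
`e.baseSet × S` (inversion is smooth on invertible operators, Mathlib's
`ContinuousLinearMap.IsInvertible.contDiffAt_map_inverse`).
[cite: GallotHulinLafontaine2004, Prop. 2.54 (p. 70)] -/
theorem IsContMDiffFamilyOn.contMDiffOn_gramOp_inverse (hg : IsContMDiffFamilyOn ∞ g S) :
    ContMDiffOn (I.prod 𝓘(ℝ, ℝ)) 𝓘(ℝ, (E →L[ℝ] ℝ) →L[ℝ] E) ∞
      (fun p : M × ℝ ↦ (ContinuousLinearMap.bilinearComp
        (show E →L[ℝ] E →L[ℝ] ℝ from (g p.2).val p.1)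
        (show E →L[ℝ] E from (trivializationAt E (TangentSpace I : M → Type _) x₀).symmL ℝ p.1) (show E →L[ℝ] E from (trivializationAt E (TangentSpace I : M → Type _) x₀).symmL ℝ p.1)).inverse)
      ((trivializationAt E (TangentSpace I : M → Type _) x₀).baseSet ×ˢ S) := by
  intro p hp
  have hG := hg.contMDiffOn_gramOp x₀ p hp
  have hi := ((g p.2).isInvertible_bilinearComp_symmL hp.1).contDiffAt_map_inverse (n := ∞)
  exact ContDiffAt.comp_contMDiffWithinAt (g := ContinuousLinearMap.inverse) (x := p) hi hG

omit [FiniteDimensional ℝ E] in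
/-- **The Koszul functional of a smooth family on frame fields is jointly smooth.** For `C^∞`
frame fields `X_u, X_v, X_w` of the trivialization at `x₀` and a family `g` that is `C^∞` on
`M × S`, `(x, t) ↦ K_t(X_u, X_v, X_w)(x) = X_u g_t(X_v,X_w) + X_v g_t(X_w,X_u) - X_w g_t(X_u,X_v)
- g_t(X_u,[X_v,X_w]) + g_t(X_v,[X_w,X_u]) + g_t(X_w,[X_u,X_v])` is `C^∞` on `e.baseSet × S`: the
derivative terms by `contMDiffOn_mvfderiv_slice`, the bracket terms by
`IsContMDiffFamilyOn.contMDiffOn_val_apply_of_section`. This is the joint regularity of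
`∂ⱼ g_{kl}(x, t)` in Gallot–Hulin–Lafontaine 2004, Prop. 2.54.
[cite: GallotHulinLafontaine2004, Prop. 2.54 (p. 70)] -/
theorem IsContMDiffFamilyOn.contMDiffOn_koszulFunctional_symmL (hg : IsContMDiffFamilyOn ∞ g S)
    (u v w : E) :
    ContMDiffOn (I.prod 𝓘(ℝ, ℝ)) 𝓘(ℝ, ℝ) ∞
      (fun p : M × ℝ ↦ (g p.2).koszulFunctional (fun y : M ↦ (trivializationAt E (TangentSpace I : M → Type _) x₀).symmL ℝ y u)
        (fun y : M ↦ (trivializationAt E (TangentSpace I : M → Type _) x₀).symmL ℝ y v) (fun y : M ↦ (trivializationAt E (TangentSpace I : M → Type _) x₀).symmL ℝ y w) p.1)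
      ((trivializationAt E (TangentSpace I : M → Type _) x₀).baseSet ×ˢ S) := by
  have hX := contMDiffOn_symmL_baseSet (I := I) x₀
  -- derivative terms `X_a g(X_b, X_c)`
  have hd : ∀ a b c : E, ContMDiffOn (I.prod 𝓘(ℝ, ℝ)) 𝓘(ℝ, ℝ) ∞
      (fun p : M × ℝ ↦ mvfderiv I (fun z ↦ (g p.2).val z ((trivializationAt E (TangentSpace I : M → Type _) x₀).symmL ℝ z b)
        ((trivializationAt E (TangentSpace I : M → Type _) x₀).symmL ℝ z c)) p.1 ((trivializationAt E (TangentSpace I : M → Type _) x₀).symmL ℝ p.1 a)) ((trivializationAt E (TangentSpace I : M → Type _) x₀).baseSet ×ˢ S) := by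
    intro a b c
    exact contMDiffOn_mvfderiv_slice x₀ (trivializationAt E (TangentSpace I : M → Type _) x₀).open_baseSet Subset.rfl
      (F := fun q : M × ℝ ↦ (g q.2).val q.1 ((trivializationAt E (TangentSpace I : M → Type _) x₀).symmL ℝ q.1 b) ((trivializationAt E (TangentSpace I : M → Type _) x₀).symmL ℝ q.1 c))
      (hg.contMDiffOn_val_apply (hX b) (hX c)) a
  -- bracket terms `g(X_a, [X_b, X_c])`
  have hb : ∀ a b c : E, ContMDiffOn (I.prod 𝓘(ℝ, ℝ)) 𝓘(ℝ, ℝ) ∞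
      (fun p : M × ℝ ↦ (g p.2).val p.1 ((trivializationAt E (TangentSpace I : M → Type _) x₀).symmL ℝ p.1 a)
        (mlieBracket I (fun y : M ↦ (trivializationAt E (TangentSpace I : M → Type _) x₀).symmL ℝ y b) (fun y : M ↦ (trivializationAt E (TangentSpace I : M → Type _) x₀).symmL ℝ y c) p.1))
      ((trivializationAt E (TangentSpace I : M → Type _) x₀).baseSet ×ˢ S) := fun a b c ↦
    hg.contMDiffOn_val_apply (hX a) (contMDiffOn_mlieBracket_symmL x₀ b c)
  have heq : (fun p : M × ℝ ↦ (g p.2).koszulFunctional (fun y : M ↦ (trivializationAt E (TangentSpace I : M → Type _) x₀).symmL ℝ y u)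
      (fun y : M ↦ (trivializationAt E (TangentSpace I : M → Type _) x₀).symmL ℝ y v) (fun y : M ↦ (trivializationAt E (TangentSpace I : M → Type _) x₀).symmL ℝ y w) p.1) = fun p ↦
      mvfderiv I (fun z ↦ (g p.2).val z ((trivializationAt E (TangentSpace I : M → Type _) x₀).symmL ℝ z v) ((trivializationAt E (TangentSpace I : M → Type _) x₀).symmL ℝ z w)) p.1
          ((trivializationAt E (TangentSpace I : M → Type _) x₀).symmL ℝ p.1 u)
        + mvfderiv I (fun z ↦ (g p.2).val z ((trivializationAt E (TangentSpace I : M → Type _) x₀).symmL ℝ z w) ((trivializationAt E (TangentSpace I : M → Type _) x₀).symmL ℝ z u)) p.1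
          ((trivializationAt E (TangentSpace I : M → Type _) x₀).symmL ℝ p.1 v)
        - mvfderiv I (fun z ↦ (g p.2).val z ((trivializationAt E (TangentSpace I : M → Type _) x₀).symmL ℝ z u) ((trivializationAt E (TangentSpace I : M → Type _) x₀).symmL ℝ z v)) p.1
          ((trivializationAt E (TangentSpace I : M → Type _) x₀).symmL ℝ p.1 w)
        - (g p.2).val p.1 ((trivializationAt E (TangentSpace I : M → Type _) x₀).symmL ℝ p.1 u)
          (mlieBracket I (fun y : M ↦ (trivializationAt E (TangentSpace I : M → Type _) x₀).symmL ℝ y v) (fun y : M ↦ (trivializationAt E (TangentSpace I : M → Type _) x₀).symmL ℝ y w) p.1)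
        + (g p.2).val p.1 ((trivializationAt E (TangentSpace I : M → Type _) x₀).symmL ℝ p.1 v)
          (mlieBracket I (fun y : M ↦ (trivializationAt E (TangentSpace I : M → Type _) x₀).symmL ℝ y w) (fun y : M ↦ (trivializationAt E (TangentSpace I : M → Type _) x₀).symmL ℝ y u) p.1)
        + (g p.2).val p.1 ((trivializationAt E (TangentSpace I : M → Type _) x₀).symmL ℝ p.1 w)
          (mlieBracket I (fun y : M ↦ (trivializationAt E (TangentSpace I : M → Type _) x₀).symmL ℝ y u) (fun y : M ↦ (trivializationAt E (TangentSpace I : M → Type _) x₀).symmL ℝ y v) p.1) := by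
    funext p; rfl
  rw [heq]
  exact ((((hd u v w).add (hd v w u)).sub (hd w u v)).sub (hb u v w)).add (hb v w u)
    |>.add (hb w u v)

variable {cov : ℝ → CovariantDerivative I E (TangentSpace I : M → Type _)}

/-- **The Christoffel data of a smooth family with Levi-Civita witnesses are jointly smooth.**
For a family `g` of `C^∞` metrics, `C^∞` on `M × S`, Levi-Civita witnesses `cov t` of `g t`
(`t ∈ S`), the trivialization `e` of `TM` at `x₀` with frame fields `X_v : y ↦ e.symmL y v`, and
`u, v ∈ E`, the coordinates `(x, t) ↦ e_x(∇^t_{X_v} X_u (x)) ∈ E` of the covariant derivatives of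
the frame are `C^∞` on `e.baseSet × S`. Proof (Gallot–Hulin–Lafontaine 2004, Prop. 2.54, with
parameters): by the Koszul formula for the torsion-free compatible `cov t`
(`IsLeviCivita.two_mul_val_apply_eq_koszulFunctional`), `G(x,t) (e_x ∇^t_{X_v} X_u) =
(w ↦ ½ K_t(X_v, X_u, X_w)(x))`, which is jointly `C^∞`
(`contMDiffOn_koszulFunctional_symmL`), and `G⁻¹` is jointly `C^∞`
(`contMDiffOn_gramOp_inverse`). [cite: GallotHulinLafontaine2004, Prop. 2.54 (p. 70)] -/
theorem IsContMDiffFamilyOn.contMDiffOn_christoffelCoord (hg : IsContMDiffFamilyOn ∞ g S)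
    (hLC : ∀ t ∈ S, (g t).IsLeviCivita (cov t)) (u v : E) :
    ContMDiffOn (I.prod 𝓘(ℝ, ℝ)) 𝓘(ℝ, E) ∞
      (fun p : M × ℝ ↦ (trivializationAt E (TangentSpace I : M → Type _) x₀).continuousLinearMapAt ℝ p.1
        ((cov p.2) (fun y : M ↦ (trivializationAt E (TangentSpace I : M → Type _) x₀).symmL ℝ y u) p.1 ((trivializationAt E (TangentSpace I : M → Type _) x₀).symmL ℝ p.1 v)))
      ((trivializationAt E (TangentSpace I : M → Type _) x₀).baseSet ×ˢ S) := by
  have hXd := fun (a : E) {y : M} (hy : y ∈ (trivializationAt E (TangentSpace I : M → Type _) x₀).baseSet) ↦ mdifferentiableAt_symmL x₀ a hy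
  -- the Gram operator and the coordinate vector
  set G : M × ℝ → E →L[ℝ] E →L[ℝ] ℝ := fun p ↦ ContinuousLinearMap.bilinearComp
    (show E →L[ℝ] E →L[ℝ] ℝ from (g p.2).val p.1)
    (show E →L[ℝ] E from (trivializationAt E (TangentSpace I : M → Type _) x₀).symmL ℝ p.1) (show E →L[ℝ] E from (trivializationAt E (TangentSpace I : M → Type _) x₀).symmL ℝ p.1) with hG_def
  have hGapply : ∀ p a b, G p a b = (g p.2).val p.1 ((trivializationAt E (TangentSpace I : M → Type _) x₀).symmL ℝ p.1 a) ((trivializationAt E (TangentSpace I : M → Type _) x₀).symmL ℝ p.1 b) :=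
    fun p a b ↦ rfl
  set c : M × ℝ → E := fun p ↦ (trivializationAt E (TangentSpace I : M → Type _) x₀).continuousLinearMapAt ℝ p.1
    ((cov p.2) (fun y : M ↦ (trivializationAt E (TangentSpace I : M → Type _) x₀).symmL ℝ y u) p.1 ((trivializationAt E (TangentSpace I : M → Type _) x₀).symmL ℝ p.1 v)) with hc_def
  -- `φ p = G p (c p)` is half the Koszul functional
  set φ : M × ℝ → E →L[ℝ] ℝ := fun p ↦ G p (c p) with hφ_def
  have hφapply : ∀ p ∈ (trivializationAt E (TangentSpace I : M → Type _) x₀).baseSet ×ˢ S, ∀ w : E, φ p w =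
      (1 / 2 : ℝ) * (g p.2).koszulFunctional (fun y : M ↦ (trivializationAt E (TangentSpace I : M → Type _) x₀).symmL ℝ y v)
        (fun y : M ↦ (trivializationAt E (TangentSpace I : M → Type _) x₀).symmL ℝ y u) (fun y : M ↦ (trivializationAt E (TangentSpace I : M → Type _) x₀).symmL ℝ y w) p.1 := by
    intro p hp w
    have h1 : φ p w = (g p.2).val p.1 ((trivializationAt E (TangentSpace I : M → Type _) x₀).symmL ℝ p.1 (c p)) ((trivializationAt E (TangentSpace I : M → Type _) x₀).symmL ℝ p.1 w) :=
      hGapply p (c p) w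
    have h2 : (trivializationAt E (TangentSpace I : M → Type _) x₀).symmL ℝ p.1 (c p) =
        (cov p.2) (fun y : M ↦ (trivializationAt E (TangentSpace I : M → Type _) x₀).symmL ℝ y u) p.1 ((trivializationAt E (TangentSpace I : M → Type _) x₀).symmL ℝ p.1 v) :=
      (trivializationAt E (TangentSpace I : M → Type _) x₀).symmL_continuousLinearMapAt hp.1 _
    rw [h1, h2, ← (hLC p.2 hp.2).two_mul_val_apply_eq_koszulFunctional (hXd v hp.1) (hXd u hp.1)
      (hXd w hp.1)]
    ring
  have hφ : ContMDiffOn (I.prod 𝓘(ℝ, ℝ)) 𝓘(ℝ, E →L[ℝ] ℝ) ∞ φ ((trivializationAt E (TangentSpace I : M → Type _) x₀).baseSet ×ˢ S) := by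
    intro p hp
    rw [contMDiffWithinAt_clm_apply_iff]
    intro w
    have hK := ((contDiff_const (c := (1 / 2 : ℝ))).mul contDiff_id).comp_contMDiffWithinAt
      (hg.contMDiffOn_koszulFunctional_symmL x₀ v u w p hp)
    refine hK.congr_of_eventuallyEq_of_mem ?_ hp
    exact Filter.eventually_of_mem self_mem_nhdsWithin fun q hq ↦ hφapply q hq w
  -- `c = G⁻¹ φ`
  have hc : ∀ p ∈ (trivializationAt E (TangentSpace I : M → Type _) x₀).baseSet ×ˢ S, c p = (G p).inverse (φ p) := fun p hp ↦
    (((g p.2).isInvertible_bilinearComp_symmL hp.1).inverse_apply_self (c p)).symm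
  intro p hp
  refine ((hg.contMDiffOn_gramOp_inverse x₀ p hp).clm_apply (hφ p hp)).congr_of_eventuallyEq_of_mem
    ?_ hp
  exact Filter.eventually_of_mem self_mem_nhdsWithin fun q hq ↦ hc q hq

end Frame

/-! ### Second covariant derivatives, the bracket term and the curvature in the frame -/

section SecondOrder

variable {E : Type*} [NormedAddCommGroup E] [NormedSpace ℝ E] {H : Type*} [TopologicalSpace H]
  {I : ModelWithCorners ℝ E H} {M : Type*} [TopologicalSpace M] [ChartedSpace H M]
  [IsManifold I ∞ M] (x₀ : M)

/-- **Covariant derivative of a finite combination `∑ fᵢ τᵢ`** (additivity and the Leibniz rule of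
a covariant derivative, Mathlib's `IsCovariantDerivativeOn.add/leibniz`, iterated): at a point
where the functions `fᵢ` and the sections `τᵢ` are differentiable,
`∇(∑ᵢ fᵢ τᵢ)_x = ∑ᵢ (fᵢ(x) (∇τᵢ)_x + dfᵢ|_x ⊗ τᵢ(x))`. [folklore] -/
theorem cov_sum_smul_eq (cov : CovariantDerivative I E (TangentSpace I : M → Type _))
    {ι : Type*} (s : Finset ι) {f : ι → M → ℝ} {τ : ι → Π x : M, TangentSpace I x} {x : M}
    (hf : ∀ i ∈ s, MDiffAt (f i) x) (hτ : ∀ i ∈ s, MDiffAt (T% (τ i)) x) :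
    cov (fun y ↦ ∑ i ∈ s, f i y • τ i y) x =
      ∑ i ∈ s, (f i x • cov (τ i) x + (mvfderiv I (f i) x).smulRight (τ i x)) := by
  classical
  induction s using Finset.induction_on with
  | empty =>
    have h0 : (fun y ↦ ∑ i ∈ (∅ : Finset ι), f i y • τ i y) = (0 : Π x : M, TangentSpace I x) := by
      funext y; simp
    rw [h0, cov.zero]
    simp
  | insert a s ha ih =>
    have hf' : ∀ i ∈ s, MDiffAt (f i) x := fun i hi ↦ hf i (Finset.mem_insert_of_mem hi)
    have hτ' : ∀ i ∈ s, MDiffAt (T% (τ i)) x := fun i hi ↦ hτ i (Finset.mem_insert_of_mem hi)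
    have hfa : MDiffAt (f a) x := hf a (Finset.mem_insert_self a s)
    have hτa : MDiffAt (T% (τ a)) x := hτ a (Finset.mem_insert_self a s)
    have hsplit : (fun y ↦ ∑ i ∈ insert a s, f i y • τ i y) =
        (f a • τ a) + (fun y ↦ ∑ i ∈ s, f i y • τ i y) := by
      funext y
      simp [Finset.sum_insert ha]
    have hsum : MDiffAt (T% (fun y ↦ ∑ i ∈ s, f i y • τ i y)) x :=
      MDifferentiableAt.sum_section fun i hi ↦ (hf' i hi).smul_section (hτ' i hi)
    have hprod : MDiffAt (T% ((f a • τ a) : Π x : M, TangentSpace I x)) x :=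
      hfa.smul_section hτa
    rw [hsplit, cov.isCovariantDerivativeOnUniv.add hprod hsum,
      cov.isCovariantDerivativeOnUniv.leibniz hτa hfa, ih hf' hτ', Finset.sum_insert ha]

/-- **Expansion of a tangent vector in the frame of a trivialization**: for `x` in the base set of
the trivialization `e` of `TM` at `x₀` and a basis `b` of `E`,
`w = ∑ᵢ bⁱ(e_x w) · e.symmL x bᵢ`. [folklore] -/
theorem eq_sum_repr_smul_symmL {ι : Type*} [Fintype ι] (b : Module.Basis ι ℝ E) {x : M}
    (hx : x ∈ (trivializationAt E (TangentSpace I : M → Type _) x₀).baseSet) (w : TangentSpace I x) :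
    w = ∑ i, b.repr ((trivializationAt E (TangentSpace I : M → Type _) x₀).continuousLinearMapAt ℝ x w) i • (trivializationAt E (TangentSpace I : M → Type _) x₀).symmL ℝ x (b i) := by
  conv_lhs => rw [← (trivializationAt E (TangentSpace I : M → Type _) x₀).symmL_continuousLinearMapAt (R := ℝ) hx w,
    ← b.sum_repr ((trivializationAt E (TangentSpace I : M → Type _) x₀).continuousLinearMapAt ℝ x w)]
  simp only [map_sum, map_smul]

variable [FiniteDimensional ℝ E] [CompleteSpace E]
  {g : ℝ → PseudoRiemannianMetric I ∞ E (TangentSpace I : M → Type _)} {S : Set ℝ}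
  {cov : ℝ → CovariantDerivative I E (TangentSpace I : M → Type _)}

/-- **Second covariant derivatives of the frame are jointly smooth.** For a family `g` of `C^∞`
metrics that is `C^∞` on `M × S`, Levi-Civita witnesses `cov t` (`t ∈ S`), the trivialization `e`
of `TM` at `x₀` with frame `X_v : y ↦ e.symmL y v`, and `v, u, u' ∈ E`, the coordinates
`(x, t) ↦ e_x(∇^t_{X_v} ∇^t_{X_u} X_{u'} (x))` are `C^∞` on `e.baseSet × S`. Proof: near `x` the
inner field is `∇^t_{X_u} X_{u'} = ∑ᵢ cᵢ(·, t) X_{bᵢ}` with `cᵢ` the (jointly `C^∞`,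
`contMDiffOn_christoffelCoord`) coordinates in a basis `bᵢ` of `E`; by locality, additivity and
the Leibniz rule of `∇^t`, `e_x(∇_{X_v}(∑ᵢ cᵢ X_{bᵢ})) = ∑ᵢ (cᵢ e_x(∇_{X_v} X_{bᵢ}) + (X_v cᵢ) bᵢ)`,
whose terms are jointly `C^∞` (`contMDiffOn_mvfderiv_slice` for `X_v cᵢ`). This is the
space-time regularity of `∂Γ + ΓΓ` in the coordinate formula for the curvature
(Gallot–Hulin–Lafontaine 2004, 3.A.3). [cite: GallotHulinLafontaine2004, 3.A.3 (p. 108)] -/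
theorem IsContMDiffFamilyOn.contMDiffOn_secondCovDerivCoord (hg : IsContMDiffFamilyOn ∞ g S)
    (hLC : ∀ t ∈ S, (g t).IsLeviCivita (cov t)) (v u u' : E) :
    ContMDiffOn (I.prod 𝓘(ℝ, ℝ)) 𝓘(ℝ, E) ∞
      (fun p : M × ℝ ↦ (trivializationAt E (TangentSpace I : M → Type _) x₀).continuousLinearMapAt ℝ p.1
        ((cov p.2) (fun y : M ↦ (cov p.2) (fun z : M ↦ (trivializationAt E (TangentSpace I : M → Type _) x₀).symmL ℝ z u') y ((trivializationAt E (TangentSpace I : M → Type _) x₀).symmL ℝ y u))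
          p.1 ((trivializationAt E (TangentSpace I : M → Type _) x₀).symmL ℝ p.1 v)))
      ((trivializationAt E (TangentSpace I : M → Type _) x₀).baseSet ×ˢ S) := by
  classical
  set bE := Module.finBasis ℝ E with hbE
  have hXd := fun (a : E) {y : M} (hy : y ∈ (trivializationAt E (TangentSpace I : M → Type _) x₀).baseSet) ↦ mdifferentiableAt_symmL x₀ a hy
  -- Christoffel coordinates `Γ a b p = e (∇_{X_b} X_a)` and the components `c i` of `Γ u' u`
  set Γ : E → E → M × ℝ → E := fun a b p ↦ (trivializationAt E (TangentSpace I : M → Type _) x₀).continuousLinearMapAt ℝ p.1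
    ((cov p.2) (fun y : M ↦ (trivializationAt E (TangentSpace I : M → Type _) x₀).symmL ℝ y a) p.1 ((trivializationAt E (TangentSpace I : M → Type _) x₀).symmL ℝ p.1 b)) with hΓ_def
  have hΓ : ∀ a b, ContMDiffOn (I.prod 𝓘(ℝ, ℝ)) 𝓘(ℝ, E) ∞ (Γ a b) ((trivializationAt E (TangentSpace I : M → Type _) x₀).baseSet ×ˢ S) :=
    fun a b ↦ hg.contMDiffOn_christoffelCoord x₀ hLC a b
  set c : Fin (Module.finrank ℝ E) → M × ℝ → ℝ := fun i p ↦ bE.repr (Γ u' u p) i with hc_def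
  have hc : ∀ i, ContMDiffOn (I.prod 𝓘(ℝ, ℝ)) 𝓘(ℝ, ℝ) ∞ (c i) ((trivializationAt E (TangentSpace I : M → Type _) x₀).baseSet ×ˢ S) := by
    intro i p hp
    have h := (LinearMap.toContinuousLinearMap (bE.coord i)).contDiff.comp_contMDiffWithinAt
      (hΓ u' u p hp)
    exact h
  have hdc : ∀ i, ContMDiffOn (I.prod 𝓘(ℝ, ℝ)) 𝓘(ℝ, ℝ) ∞
      (fun p : M × ℝ ↦ mvfderiv I (fun y ↦ c i (y, p.2)) p.1 ((trivializationAt E (TangentSpace I : M → Type _) x₀).symmL ℝ p.1 v))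
      ((trivializationAt E (TangentSpace I : M → Type _) x₀).baseSet ×ˢ S) :=
    fun i ↦ contMDiffOn_mvfderiv_slice x₀ (trivializationAt E (TangentSpace I : M → Type _) x₀).open_baseSet Subset.rfl (hc i) v
  -- the formula
  have formula : ∀ p ∈ (trivializationAt E (TangentSpace I : M → Type _) x₀).baseSet ×ˢ S,
      (trivializationAt E (TangentSpace I : M → Type _) x₀).continuousLinearMapAt ℝ p.1 ((cov p.2)
        (fun y : M ↦ (cov p.2) (fun z : M ↦ (trivializationAt E (TangentSpace I : M → Type _) x₀).symmL ℝ z u') y ((trivializationAt E (TangentSpace I : M → Type _) x₀).symmL ℝ y u))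
          p.1 ((trivializationAt E (TangentSpace I : M → Type _) x₀).symmL ℝ p.1 v)) =
      ∑ i, (c i p • Γ (bE i) v p +
        mvfderiv I (fun y ↦ c i (y, p.2)) p.1 ((trivializationAt E (TangentSpace I : M → Type _) x₀).symmL ℝ p.1 v) • bE i) := by
    rintro ⟨x, t⟩ ⟨hx, ht⟩
    -- the inner field `σ` and its frame expansion `σ'`
    set σ : Π y : M, TangentSpace I y :=
      fun y ↦ (cov t) (fun z : M ↦ (trivializationAt E (TangentSpace I : M → Type _) x₀).symmL ℝ z u') y ((trivializationAt E (TangentSpace I : M → Type _) x₀).symmL ℝ y u) with hσ_def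
    set σ' : Π y : M, TangentSpace I y :=
      fun y ↦ ∑ i, c i (y, t) • (trivializationAt E (TangentSpace I : M → Type _) x₀).symmL ℝ y (bE i) with hσ'_def
    have hσσ' : ∀ y ∈ (trivializationAt E (TangentSpace I : M → Type _) x₀).baseSet, σ y = σ' y := by
      intro y hy
      rw [hσ'_def]
      dsimp only
      rw [eq_sum_repr_smul_symmL x₀ bE hy (σ y)]
    have hcd : ∀ i, MDiffAt (fun y ↦ c i (y, t)) x := fun i ↦
      ((contMDiffOn_slice (hc i) ht x hx).contMDiffAt
        ((trivializationAt E (TangentSpace I : M → Type _) x₀).open_baseSet.mem_nhds hx)).mdifferentiableAt (by simp)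
    have hσ'd : MDiffAt (T% σ') x :=
      MDifferentiableAt.sum_section fun i _ ↦ (hcd i).smul_section (hXd (bE i) hx)
    have hev : ∀ᶠ y in 𝓝 x, σ y = σ' y :=
      Filter.eventually_of_mem ((trivializationAt E (TangentSpace I : M → Type _) x₀).open_baseSet.mem_nhds hx) hσσ'
    have hσd : MDiffAt (T% σ) x := by
      refine hσ'd.congr_of_eventuallyEq ?_
      filter_upwards [hev] with y hy
      rw [hy]
    have h1 : (cov t) σ x = (cov t) σ' x :=
      (cov t).isCovariantDerivativeOn.congr_of_eventuallyEq hσd hσ'd Filter.univ_mem hev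
    have h2 : (cov t) σ' x = ∑ i, (c i (x, t) • (cov t) (fun y : M ↦ (trivializationAt E (TangentSpace I : M → Type _) x₀).symmL ℝ y (bE i)) x +
        (mvfderiv I (fun y ↦ c i (y, t)) x).smulRight ((trivializationAt E (TangentSpace I : M → Type _) x₀).symmL ℝ x (bE i))) :=
      cov_sum_smul_eq (cov t) Finset.univ (fun i _ ↦ hcd i) (fun i _ ↦ hXd (bE i) hx)
    dsimp only
    rw [h1, h2, FunLike.coe_sum, Finset.sum_apply, map_sum]
    refine Finset.sum_congr rfl fun i _ ↦ ?_
    rw [_root_.add_apply, FunLike.coe_smul, Pi.smul_apply,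
      ContinuousLinearMap.smulRight_apply, map_add, map_smul, map_smul,
      (trivializationAt E (TangentSpace I : M → Type _) x₀).continuousLinearMapAt_symmL hx]
  -- smoothness of the right-hand side
  have hrhs : ContMDiffOn (I.prod 𝓘(ℝ, ℝ)) 𝓘(ℝ, E) ∞ (fun p : M × ℝ ↦
      ∑ i, (c i p • Γ (bE i) v p +
        mvfderiv I (fun y ↦ c i (y, p.2)) p.1 ((trivializationAt E (TangentSpace I : M → Type _) x₀).symmL ℝ p.1 v) • bE i))
      ((trivializationAt E (TangentSpace I : M → Type _) x₀).baseSet ×ˢ S) := by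
    intro p hp
    refine ContMDiffWithinAt.sum fun i _ ↦ ?_
    exact ((hc i p hp).smul (hΓ (bE i) v p hp)).add ((hdc i p hp).smul contMDiffWithinAt_const)
  exact hrhs.congr formula

omit [FiniteDimensional ℝ E] in
/-- The coordinates of the Lie bracket of two frame fields are `C^∞` on the base set. [folklore] -/
theorem contMDiffOn_coord_mlieBracket_symmL (v u : E) :
    CMDiff[(trivializationAt E (TangentSpace I : M → Type _) x₀).baseSet] ∞ (fun y : M ↦ (trivializationAt E (TangentSpace I : M → Type _) x₀).continuousLinearMapAt ℝ y
      (mlieBracket I (fun z : M ↦ (trivializationAt E (TangentSpace I : M → Type _) x₀).symmL ℝ z v) (fun z : M ↦ (trivializationAt E (TangentSpace I : M → Type _) x₀).symmL ℝ z u) y)) := by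
  have h := ((trivializationAt E (TangentSpace I : M → Type _) x₀).contMDiffOn_section_baseSet_iff (IB := I) (n := (∞ : ℕ∞ω))).mp
    (contMDiffOn_mlieBracket_symmL x₀ v u)
  refine h.congr fun y hy ↦ ?_
  exact Trivialization.continuousLinearMapAt_apply_of_mem (R := ℝ) _ hy _

/-- **The bracket term of the curvature is jointly smooth**: `(x, t) ↦ e_x(∇^t_{[X_v, X_u]} X_{u'}(x))`
is `C^∞` on `e.baseSet × S` — expand `[X_v, X_u] = ∑ᵢ βᵢ X_{bᵢ}` with `C^∞` coefficients and use
linearity of `(∇ X_{u'})_x` in the direction. [folklore] -/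
theorem IsContMDiffFamilyOn.contMDiffOn_covBracketCoord (hg : IsContMDiffFamilyOn ∞ g S)
    (hLC : ∀ t ∈ S, (g t).IsLeviCivita (cov t)) (v u u' : E) :
    ContMDiffOn (I.prod 𝓘(ℝ, ℝ)) 𝓘(ℝ, E) ∞
      (fun p : M × ℝ ↦ (trivializationAt E (TangentSpace I : M → Type _) x₀).continuousLinearMapAt ℝ p.1
        ((cov p.2) (fun z : M ↦ (trivializationAt E (TangentSpace I : M → Type _) x₀).symmL ℝ z u') p.1
          (mlieBracket I (fun z : M ↦ (trivializationAt E (TangentSpace I : M → Type _) x₀).symmL ℝ z v) (fun z : M ↦ (trivializationAt E (TangentSpace I : M → Type _) x₀).symmL ℝ z u) p.1)))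
      ((trivializationAt E (TangentSpace I : M → Type _) x₀).baseSet ×ˢ S) := by
  classical
  set bE := Module.finBasis ℝ E with hbE
  set Γ : E → E → M × ℝ → E := fun a b p ↦ (trivializationAt E (TangentSpace I : M → Type _) x₀).continuousLinearMapAt ℝ p.1
    ((cov p.2) (fun y : M ↦ (trivializationAt E (TangentSpace I : M → Type _) x₀).symmL ℝ y a) p.1 ((trivializationAt E (TangentSpace I : M → Type _) x₀).symmL ℝ p.1 b)) with hΓ_def
  have hΓ : ∀ a b, ContMDiffOn (I.prod 𝓘(ℝ, ℝ)) 𝓘(ℝ, E) ∞ (Γ a b) ((trivializationAt E (TangentSpace I : M → Type _) x₀).baseSet ×ˢ S) :=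
    fun a b ↦ hg.contMDiffOn_christoffelCoord x₀ hLC a b
  set β : M → E := fun y ↦ (trivializationAt E (TangentSpace I : M → Type _) x₀).continuousLinearMapAt ℝ y
    (mlieBracket I (fun z : M ↦ (trivializationAt E (TangentSpace I : M → Type _) x₀).symmL ℝ z v) (fun z : M ↦ (trivializationAt E (TangentSpace I : M → Type _) x₀).symmL ℝ z u) y) with hβ_def
  have hβ : ∀ i, CMDiff[(trivializationAt E (TangentSpace I : M → Type _) x₀).baseSet] ∞ (fun y ↦ bE.repr (β y) i) := by
    intro i y hy
    have h := (LinearMap.toContinuousLinearMap (bE.coord i)).contDiff.comp_contMDiffWithinAt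
      (contMDiffOn_coord_mlieBracket_symmL x₀ v u y hy)
    exact h
  have formula : ∀ p ∈ (trivializationAt E (TangentSpace I : M → Type _) x₀).baseSet ×ˢ S,
      (trivializationAt E (TangentSpace I : M → Type _) x₀).continuousLinearMapAt ℝ p.1 ((cov p.2) (fun z : M ↦ (trivializationAt E (TangentSpace I : M → Type _) x₀).symmL ℝ z u') p.1
        (mlieBracket I (fun z : M ↦ (trivializationAt E (TangentSpace I : M → Type _) x₀).symmL ℝ z v) (fun z : M ↦ (trivializationAt E (TangentSpace I : M → Type _) x₀).symmL ℝ z u) p.1)) =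
      ∑ i, bE.repr (β p.1) i • Γ u' (bE i) p := by
    rintro ⟨x, t⟩ ⟨hx, -⟩
    dsimp only
    rw [eq_sum_repr_smul_symmL x₀ bE hx
      (mlieBracket I (fun z : M ↦ (trivializationAt E (TangentSpace I : M → Type _) x₀).symmL ℝ z v) (fun z : M ↦ (trivializationAt E (TangentSpace I : M → Type _) x₀).symmL ℝ z u) x)]
    simp only [map_sum, map_smul]
    rfl
  have hrhs : ContMDiffOn (I.prod 𝓘(ℝ, ℝ)) 𝓘(ℝ, E) ∞
      (fun p : M × ℝ ↦ ∑ i, bE.repr (β p.1) i • Γ u' (bE i) p) ((trivializationAt E (TangentSpace I : M → Type _) x₀).baseSet ×ˢ S) := by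
    intro p hp
    refine ContMDiffWithinAt.sum fun i _ ↦ ?_
    have hfst : ContMDiffWithinAt (I.prod 𝓘(ℝ, ℝ)) I ∞ (Prod.fst : M × ℝ → M)
        ((trivializationAt E (TangentSpace I : M → Type _) x₀).baseSet ×ˢ S) p := contMDiffWithinAt_fst
    exact ((hβ i p.1 hp.1).comp p hfst fun q hq ↦ hq.1).smul (hΓ u' (bE i) p hp)
  exact hrhs.congr formula

/-- **The curvature of a smooth family is jointly smooth in the frame**: for `v, u, u' ∈ E`,
`(x, t) ↦ e_x(R^t_x(X_v, X_u) X_{u'})`, `R^t` the curvature tensor of `cov t`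
(`CovariantDerivative.curvature`, `R(X,Y)Z = ∇_X ∇_Y Z - ∇_Y ∇_X Z - ∇_{[X,Y]} Z`), is `C^∞` on
`e.baseSet × S`: by `curvature_apply_of_isLocallyContMDiff` (`cov t` is locally `C¹`,
`IsLeviCivita.isLocallyContMDiff_one`) the tensor is computed on the frame fields, and the three
terms are jointly `C^∞` (`contMDiffOn_secondCovDerivCoord`, `contMDiffOn_covBracketCoord`).
Gallot–Hulin–Lafontaine 2004, 3.A.3 (curvature in coordinates); O'Neill 1983, Ch. 3, Lemma 3.35.
[cite: GallotHulinLafontaine2004, 3.A.3 (p. 108)] -/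
theorem IsContMDiffFamilyOn.contMDiffOn_curvatureCoord (hg : IsContMDiffFamilyOn ∞ g S)
    (hLC : ∀ t ∈ S, (g t).IsLeviCivita (cov t)) (v u u' : E) :
    ContMDiffOn (I.prod 𝓘(ℝ, ℝ)) 𝓘(ℝ, E) ∞
      (fun p : M × ℝ ↦ (trivializationAt E (TangentSpace I : M → Type _) x₀).continuousLinearMapAt ℝ p.1
        ((cov p.2).curvature p.1 ((trivializationAt E (TangentSpace I : M → Type _) x₀).symmL ℝ p.1 v) ((trivializationAt E (TangentSpace I : M → Type _) x₀).symmL ℝ p.1 u)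
          ((trivializationAt E (TangentSpace I : M → Type _) x₀).symmL ℝ p.1 u')))
      ((trivializationAt E (TangentSpace I : M → Type _) x₀).baseSet ×ˢ S) := by
  have h2 : (2 : ℕ∞ω) ≤ ∞ := WithTop.coe_le_coe.mpr le_top
  haveI : IsManifold I (minSmoothness ℝ 3) M := by
    rw [minSmoothness_of_isRCLikeNormedField]; infer_instance
  haveI : IsManifold I (minSmoothness ℝ 2) M := by
    rw [minSmoothness_of_isRCLikeNormedField]; infer_instance
  have formula : ∀ p ∈ (trivializationAt E (TangentSpace I : M → Type _) x₀).baseSet ×ˢ S,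
      (trivializationAt E (TangentSpace I : M → Type _) x₀).continuousLinearMapAt ℝ p.1
        ((cov p.2).curvature p.1 ((trivializationAt E (TangentSpace I : M → Type _) x₀).symmL ℝ p.1 v) ((trivializationAt E (TangentSpace I : M → Type _) x₀).symmL ℝ p.1 u)
          ((trivializationAt E (TangentSpace I : M → Type _) x₀).symmL ℝ p.1 u')) =
      (trivializationAt E (TangentSpace I : M → Type _) x₀).continuousLinearMapAt ℝ p.1
        ((cov p.2) (fun y : M ↦ (cov p.2) (fun z : M ↦ (trivializationAt E (TangentSpace I : M → Type _) x₀).symmL ℝ z u') y ((trivializationAt E (TangentSpace I : M → Type _) x₀).symmL ℝ y u))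
          p.1 ((trivializationAt E (TangentSpace I : M → Type _) x₀).symmL ℝ p.1 v))
      - (trivializationAt E (TangentSpace I : M → Type _) x₀).continuousLinearMapAt ℝ p.1
        ((cov p.2) (fun y : M ↦ (cov p.2) (fun z : M ↦ (trivializationAt E (TangentSpace I : M → Type _) x₀).symmL ℝ z u') y ((trivializationAt E (TangentSpace I : M → Type _) x₀).symmL ℝ y v))
          p.1 ((trivializationAt E (TangentSpace I : M → Type _) x₀).symmL ℝ p.1 u))
      - (trivializationAt E (TangentSpace I : M → Type _) x₀).continuousLinearMapAt ℝ p.1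
        ((cov p.2) (fun z : M ↦ (trivializationAt E (TangentSpace I : M → Type _) x₀).symmL ℝ z u') p.1
          (mlieBracket I (fun z : M ↦ (trivializationAt E (TangentSpace I : M → Type _) x₀).symmL ℝ z v) (fun z : M ↦ (trivializationAt E (TangentSpace I : M → Type _) x₀).symmL ℝ z u) p.1)) := by
    rintro ⟨x, t⟩ ⟨hx, ht⟩
    dsimp only
    have h1 : (cov t).IsLocallyContMDiff 1 := (hLC t ht).isLocallyContMDiff_one h2
    rw [(cov t).curvature_apply_of_isLocallyContMDiff h1 (X := fun z : M ↦ (trivializationAt E (TangentSpace I : M → Type _) x₀).symmL ℝ z v)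
      (Y := fun z : M ↦ (trivializationAt E (TangentSpace I : M → Type _) x₀).symmL ℝ z u) (Z := fun z : M ↦ (trivializationAt E (TangentSpace I : M → Type _) x₀).symmL ℝ z u')
      (mdifferentiableAt_symmL x₀ v hx) (mdifferentiableAt_symmL x₀ u hx)
      ((contMDiffAt_symmL x₀ u' hx).of_le (by rw [minSmoothness_of_isRCLikeNormedField]; exact h2))]
    simp only [CovariantDerivative.curvatureAux, map_sub]
  refine (((hg.contMDiffOn_secondCovDerivCoord x₀ hLC v u u').sub
    (hg.contMDiffOn_secondCovDerivCoord x₀ hLC u v u')).sub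
    (hg.contMDiffOn_covBracketCoord x₀ hLC v u u')).congr formula

end SecondOrder

/-! ### The Ricci tensor and the scalar curvature of a smooth family are jointly smooth -/

section Ricci

variable {E : Type*} [NormedAddCommGroup E] [NormedSpace ℝ E] {H : Type*} [TopologicalSpace H]
  {I : ModelWithCorners ℝ E H} {M : Type*} [TopologicalSpace M] [ChartedSpace H M]
  [IsManifold I ∞ M] (x₀ : M)

/-- The basis `e.basisAt b hx` of `T_x M` consists of the frame vectors `e.symmL x (b i)`.
[folklore] -/
theorem basisAt_eq_symmL {ι : Type*} (b : Module.Basis ι ℝ E) {x : M} (hx : x ∈ (trivializationAt E (TangentSpace I : M → Type _) x₀).baseSet)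
    (i : ι) : (trivializationAt E (TangentSpace I : M → Type _) x₀).basisAt b hx i = (trivializationAt E (TangentSpace I : M → Type _) x₀).symmL ℝ x (b i) := by
  simp only [Trivialization.basisAt, Module.Basis.map_apply, Trivialization.linearEquivAt_symm_apply]
  exact (Trivialization.symmL_apply (R := ℝ) _ hx _).symm

/-- Coordinates in the basis `e.basisAt b hx` are the `b`-coordinates of the trivialized vector:
`(e.basisAt b hx).repr w = b.repr (e_x w)`. [folklore] -/
theorem basisAt_repr {ι : Type*} (b : Module.Basis ι ℝ E) {x : M} (hx : x ∈ (trivializationAt E (TangentSpace I : M → Type _) x₀).baseSet)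
    (w : TangentSpace I x) :
    ((trivializationAt E (TangentSpace I : M → Type _) x₀).basisAt b hx).repr w = b.repr ((trivializationAt E (TangentSpace I : M → Type _) x₀).continuousLinearMapAt ℝ x w) := by
  rw [Trivialization.continuousLinearMapAt_apply_of_mem (R := ℝ) _ hx]
  simp [Trivialization.basisAt]

variable [FiniteDimensional ℝ E] [CompleteSpace E]
  {g : ℝ → PseudoRiemannianMetric I ∞ E (TangentSpace I : M → Type _)} {S : Set ℝ}
  {cov : ℝ → CovariantDerivative I E (TangentSpace I : M → Type _)}

/-- **The Ricci tensor of a smooth family is jointly smooth in the frame** (O'Neill 1983, Ch. 3,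
Def. 3.51: `Ric = C¹₃(R)`; Lee, (7.24): `Ric(X,Y) = tr (v ↦ R(v,X)Y)`): for `u, u' ∈ E`,
`(x, t) ↦ Ric^t_x(X_u, X_{u'}) = ∑ᵢ bⁱ(e_x R^t_x(X_{bᵢ}, X_u) X_{u'})` is `C^∞` on `e.baseSet × S`
(`contMDiffOn_curvatureCoord`). [cite: ONeill1983, Ch. 3, Def. 3.51] -/
theorem IsContMDiffFamilyOn.contMDiffOn_ricci_symmL (hg : IsContMDiffFamilyOn ∞ g S)
    (hLC : ∀ t ∈ S, (g t).IsLeviCivita (cov t)) (u u' : E) :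
    ContMDiffOn (I.prod 𝓘(ℝ, ℝ)) 𝓘(ℝ, ℝ) ∞
      (fun p : M × ℝ ↦ (cov p.2).ricci p.1 ((trivializationAt E (TangentSpace I : M → Type _) x₀).symmL ℝ p.1 u) ((trivializationAt E (TangentSpace I : M → Type _) x₀).symmL ℝ p.1 u'))
      ((trivializationAt E (TangentSpace I : M → Type _) x₀).baseSet ×ˢ S) := by
  classical
  set bE := Module.finBasis ℝ E with hbE
  have formula : ∀ p ∈ (trivializationAt E (TangentSpace I : M → Type _) x₀).baseSet ×ˢ S,
      (cov p.2).ricci p.1 ((trivializationAt E (TangentSpace I : M → Type _) x₀).symmL ℝ p.1 u) ((trivializationAt E (TangentSpace I : M → Type _) x₀).symmL ℝ p.1 u') =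
      ∑ i, bE.repr ((trivializationAt E (TangentSpace I : M → Type _) x₀).continuousLinearMapAt ℝ p.1 ((cov p.2).curvature p.1
        ((trivializationAt E (TangentSpace I : M → Type _) x₀).symmL ℝ p.1 (bE i)) ((trivializationAt E (TangentSpace I : M → Type _) x₀).symmL ℝ p.1 u) ((trivializationAt E (TangentSpace I : M → Type _) x₀).symmL ℝ p.1 u'))) i := by
    rintro ⟨x, t⟩ ⟨hx, -⟩
    dsimp only
    haveI : FiniteDimensional ℝ (TangentSpace I x) := ‹FiniteDimensional ℝ E›
    rw [CovariantDerivative.ricci_apply, LinearMap.trace_eq_matrix_trace ℝ ((trivializationAt E (TangentSpace I : M → Type _) x₀).basisAt bE hx),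
      Matrix.trace]
    refine Finset.sum_congr rfl fun i _ ↦ ?_
    rw [Matrix.diag_apply, LinearMap.toMatrix_apply, CovariantDerivative.ricciAux_apply,
      basisAt_repr x₀ bE hx, basisAt_eq_symmL x₀ bE hx]
  have hrhs : ContMDiffOn (I.prod 𝓘(ℝ, ℝ)) 𝓘(ℝ, ℝ) ∞ (fun p : M × ℝ ↦
      ∑ i, bE.repr ((trivializationAt E (TangentSpace I : M → Type _) x₀).continuousLinearMapAt ℝ p.1 ((cov p.2).curvature p.1
        ((trivializationAt E (TangentSpace I : M → Type _) x₀).symmL ℝ p.1 (bE i)) ((trivializationAt E (TangentSpace I : M → Type _) x₀).symmL ℝ p.1 u) ((trivializationAt E (TangentSpace I : M → Type _) x₀).symmL ℝ p.1 u'))) i)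
      ((trivializationAt E (TangentSpace I : M → Type _) x₀).baseSet ×ˢ S) := by
    intro p hp
    refine ContMDiffWithinAt.sum fun i _ ↦ ?_
    have h := (LinearMap.toContinuousLinearMap (bE.coord i)).contDiff.comp_contMDiffWithinAt
      (hg.contMDiffOn_curvatureCoord x₀ hLC (bE i) u u' p hp)
    exact h
  exact hrhs.congr formula

/-- **The scalar curvature of a smooth family is jointly smooth, locally** (O'Neill 1983, Ch. 3,
Def. 3.53: "the scalar curvature `S` of `M` is the contraction `C(Ric) ∈ 𝔉(M)`"): on
`e.baseSet × S`, `R(x, t) = tr_{g_t} Ric^t(x) = ∑ᵢⱼ (G(x,t)⁻¹)ⱼᵢ Ric^t(X_{bᵢ}, X_{bⱼ})(x)`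
(`trace_eq_sum_gram_inv`) with the inverse Gram matrix jointly `C^∞`
(`contMDiffWithinAt_matrix_inv`) and the Ricci components jointly `C^∞` (`contMDiffOn_ricci_symmL`).
[cite: ONeill1983, Ch. 3, Def. 3.53] -/
theorem IsContMDiffFamilyOn.contMDiffOn_scalarCurvatureWith_baseSet (hg : IsContMDiffFamilyOn ∞ g S)
    (hLC : ∀ t ∈ S, (g t).IsLeviCivita (cov t)) :
    ContMDiffOn (I.prod 𝓘(ℝ, ℝ)) 𝓘(ℝ, ℝ) ∞
      (fun p : M × ℝ ↦ (g p.2).scalarCurvatureWith (cov p.2) p.1) ((trivializationAt E (TangentSpace I : M → Type _) x₀).baseSet ×ˢ S) := by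
  classical
  set bE := Module.finBasis ℝ E with hbE
  -- the Gram matrix, its determinant and inverse
  set Gm : M × ℝ → Matrix (Fin (Module.finrank ℝ E)) (Fin (Module.finrank ℝ E)) ℝ := fun p ↦
    Matrix.of fun i j ↦ (g p.2).val p.1 ((trivializationAt E (TangentSpace I : M → Type _) x₀).symmL ℝ p.1 (bE i)) ((trivializationAt E (TangentSpace I : M → Type _) x₀).symmL ℝ p.1 (bE j))
    with hGm_def
  have hGm : ∀ i j, ContMDiffOn (I.prod 𝓘(ℝ, ℝ)) 𝓘(ℝ, ℝ) ∞ (fun p ↦ Gm p i j)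
      ((trivializationAt E (TangentSpace I : M → Type _) x₀).baseSet ×ˢ S) := fun i j ↦
    hg.contMDiffOn_val_apply (contMDiffOn_symmL_baseSet x₀ (bE i))
      (contMDiffOn_symmL_baseSet x₀ (bE j))
  have hdet : ∀ p ∈ (trivializationAt E (TangentSpace I : M → Type _) x₀).baseSet ×ˢ S, (Gm p).det ≠ 0 := by
    rintro ⟨x, t⟩ ⟨hx, -⟩
    have h := det_gram_ne_zero (g t) x ((trivializationAt E (TangentSpace I : M → Type _) x₀).basisAt bE hx)
    simp only [basisAt_eq_symmL x₀ bE hx] at h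
    exact h
  have hinv : ∀ i j, ContMDiffOn (I.prod 𝓘(ℝ, ℝ)) 𝓘(ℝ, ℝ) ∞ (fun p ↦ (Gm p)⁻¹ i j)
      ((trivializationAt E (TangentSpace I : M → Type _) x₀).baseSet ×ˢ S) := fun i j p hp ↦
    contMDiffWithinAt_matrix_inv (fun a b ↦ hGm a b p hp) (hdet p hp) i j
  -- the Ricci components
  have hRic := fun i j ↦ hg.contMDiffOn_ricci_symmL x₀ hLC (bE i) (bE j)
  -- the formula
  have formula : ∀ p ∈ (trivializationAt E (TangentSpace I : M → Type _) x₀).baseSet ×ˢ S, (g p.2).scalarCurvatureWith (cov p.2) p.1 =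
      ∑ i, ∑ j, (Gm p)⁻¹ j i * (cov p.2).ricci p.1 ((trivializationAt E (TangentSpace I : M → Type _) x₀).symmL ℝ p.1 (bE i))
        ((trivializationAt E (TangentSpace I : M → Type _) x₀).symmL ℝ p.1 (bE j)) := by
    rintro ⟨x, t⟩ ⟨hx, -⟩
    dsimp only
    rw [PseudoRiemannianMetric.scalarCurvatureWith,
      trace_eq_sum_gram_inv (g t) x ((trivializationAt E (TangentSpace I : M → Type _) x₀).basisAt bE hx)]
    simp only [basisAt_eq_symmL x₀ bE hx]
    rfl
  have hrhs : ContMDiffOn (I.prod 𝓘(ℝ, ℝ)) 𝓘(ℝ, ℝ) ∞ (fun p : M × ℝ ↦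
      ∑ i, ∑ j, (Gm p)⁻¹ j i * (cov p.2).ricci p.1 ((trivializationAt E (TangentSpace I : M → Type _) x₀).symmL ℝ p.1 (bE i))
        ((trivializationAt E (TangentSpace I : M → Type _) x₀).symmL ℝ p.1 (bE j))) ((trivializationAt E (TangentSpace I : M → Type _) x₀).baseSet ×ˢ S) := by
    intro p hp
    refine ContMDiffWithinAt.sum fun i _ ↦ ContMDiffWithinAt.sum fun j _ ↦ ?_
    exact (hinv j i p hp).mul (hRic i j p hp)
  exact hrhs.congr formula

/-- **The Ricci tensor of a smooth family on smooth fields is jointly smooth** (O'Neill 1983,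
Ch. 3, Def. 3.51: `Ric ∈ 𝔗⁰₂(M)` is a smooth tensor field; here with parameters): for vector
fields `Y, Z` of class `C^∞` on an open set `a` and a family `g`, `C^∞` on `M × S`, with
Levi-Civita witnesses `cov t`, the function `(x, t) ↦ Ric_{cov t}(x)(Y x, Z x)` is `C^∞` on
`a × S`: expand `Y = ∑ yᵢ X_{bᵢ}`, `Z = ∑ zⱼ X_{bⱼ}` in the frame of the trivialization at the
point considered and use bilinearity and `contMDiffOn_ricci_symmL`.
[cite: ONeill1983, Ch. 3, Def. 3.51] -/
theorem IsContMDiffFamilyOn.contMDiffOn_ricci_apply_of_section (hg : IsContMDiffFamilyOn ∞ g S)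
    (hLC : ∀ t ∈ S, (g t).IsLeviCivita (cov t)) {a : Set M} (ha : IsOpen a)
    {Y Z : Π x : M, TangentSpace I x} (hY : CMDiff[a] ∞ (T% Y)) (hZ : CMDiff[a] ∞ (T% Z)) :
    ContMDiffOn (I.prod 𝓘(ℝ, ℝ)) 𝓘(ℝ, ℝ) ∞
      (fun p : M × ℝ ↦ (cov p.2).ricci p.1 (Y p.1) (Z p.1)) (a ×ˢ S) := by
  classical
  intro p hp
  set bE := Module.finBasis ℝ E with hbE
  have hmem : p.1 ∈ (trivializationAt E (TangentSpace I : M → Type _) p.1).baseSet := mem_baseSet_trivializationAt E (TangentSpace I : M → Type _) p.1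
  -- the smaller set `(a ∩ (trivializationAt E (TangentSpace I : M → Type _) p.1).baseSet) × S`, a neighbourhood of `p` within `a × S`
  set a' : Set M := a ∩ (trivializationAt E (TangentSpace I : M → Type _) p.1).baseSet with ha'_def
  have ha' : IsOpen a' := ha.inter (trivializationAt E (TangentSpace I : M → Type _) p.1).open_baseSet
  have hp' : p ∈ a' ×ˢ S := ⟨⟨hp.1, hmem⟩, hp.2⟩
  have hnhds : a' ×ˢ S ∈ 𝓝[a ×ˢ S] p := by
    have hset : a' ×ˢ S = (a ×ˢ S) ∩ (Prod.fst ⁻¹' (trivializationAt E (TangentSpace I : M → Type _) p.1).baseSet) := by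
      ext q
      simp only [ha'_def, mem_prod, mem_inter_iff, mem_preimage]
      tauto
    rw [hset]
    exact inter_mem_nhdsWithin _ (((trivializationAt E (TangentSpace I : M → Type _) p.1).open_baseSet.preimage continuous_fst).mem_nhds hmem)
  -- the coordinates of `Y`, `Z` in the frame are `C^∞` on `a'`
  have hcoord : ∀ {W : Π x : M, TangentSpace I x}, CMDiff[a] ∞ (T% W) → ∀ i,
      CMDiff[a'] ∞ (fun x ↦ bE.repr ((trivializationAt E (TangentSpace I : M → Type _) p.1).continuousLinearMapAt ℝ x (W x)) i) := by
    intro W hW i x hx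
    have h1 : CMDiff[a'] ∞ (fun x ↦ ((trivializationAt E (TangentSpace I : M → Type _) p.1) ⟨x, W x⟩).2) :=
      ((trivializationAt E (TangentSpace I : M → Type _) p.1).contMDiffOn_section_iff ha' inter_subset_right).mp (hW.mono inter_subset_left)
    have h2 : CMDiff[a'] ∞ (fun x ↦ (trivializationAt E (TangentSpace I : M → Type _) p.1).continuousLinearMapAt ℝ x (W x)) :=
      h1.congr fun y hy ↦ Trivialization.continuousLinearMapAt_apply_of_mem (R := ℝ) _ hy.2 _
    have h := (LinearMap.toContinuousLinearMap (bE.coord i)).contDiff.comp_contMDiffWithinAt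
      (h2 x hx)
    exact h
  -- the bilinear expansion on `a' × S`
  have formula : ∀ q ∈ a' ×ˢ S, (cov q.2).ricci q.1 (Y q.1) (Z q.1) =
      ∑ i, ∑ j, bE.repr ((trivializationAt E (TangentSpace I : M → Type _) p.1).continuousLinearMapAt ℝ q.1 (Y q.1)) i *
        (bE.repr ((trivializationAt E (TangentSpace I : M → Type _) p.1).continuousLinearMapAt ℝ q.1 (Z q.1)) j *
          (cov q.2).ricci q.1 ((trivializationAt E (TangentSpace I : M → Type _) p.1).symmL ℝ q.1 (bE i)) ((trivializationAt E (TangentSpace I : M → Type _) p.1).symmL ℝ q.1 (bE j))) := by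
    rintro ⟨x, t⟩ ⟨⟨-, hx⟩, -⟩
    dsimp only
    conv_lhs => rw [eq_sum_repr_smul_symmL p.1 bE hx (Y x), eq_sum_repr_smul_symmL p.1 bE hx (Z x)]
    simp only [map_sum, map_smul, LinearMap.coe_sum, Finset.sum_apply, LinearMap.smul_apply,
      smul_eq_mul, Finset.mul_sum]
    rw [Finset.sum_comm]
    refine Finset.sum_congr rfl fun i _ ↦ Finset.sum_congr rfl fun j _ ↦ ?_
    ring
  have hrhs : ContMDiffOn (I.prod 𝓘(ℝ, ℝ)) 𝓘(ℝ, ℝ) ∞ (fun q : M × ℝ ↦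
      ∑ i, ∑ j, bE.repr ((trivializationAt E (TangentSpace I : M → Type _) p.1).continuousLinearMapAt ℝ q.1 (Y q.1)) i *
        (bE.repr ((trivializationAt E (TangentSpace I : M → Type _) p.1).continuousLinearMapAt ℝ q.1 (Z q.1)) j *
          (cov q.2).ricci q.1 ((trivializationAt E (TangentSpace I : M → Type _) p.1).symmL ℝ q.1 (bE i)) ((trivializationAt E (TangentSpace I : M → Type _) p.1).symmL ℝ q.1 (bE j)))) (a' ×ˢ S) := by
    intro q hq
    have hfst : ContMDiffWithinAt (I.prod 𝓘(ℝ, ℝ)) I ∞ (Prod.fst : M × ℝ → M) (a' ×ˢ S) q :=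
      contMDiffWithinAt_fst
    have hq' : q ∈ (trivializationAt E (TangentSpace I : M → Type _) p.1).baseSet ×ˢ S := ⟨hq.1.2, hq.2⟩
    refine ContMDiffWithinAt.sum fun i _ ↦ ContMDiffWithinAt.sum fun j _ ↦ ?_
    refine ((hcoord hY i q.1 hq.1).comp q hfst fun r hr ↦ hr.1).mul
      (((hcoord hZ j q.1 hq.1).comp q hfst fun r hr ↦ hr.1).mul ?_)
    exact (hg.contMDiffOn_ricci_symmL p.1 hLC (bE i) (bE j) q hq').mono
      (prod_mono inter_subset_right Subset.rfl)
  exact ((hrhs.congr formula) p hp').mono_of_mem_nhdsWithin hnhds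

end Ricci

/-! ### Main results: joint smoothness and continuity of the scalar curvature; the discharge -/

section Main

variable {E : Type*} [NormedAddCommGroup E] [NormedSpace ℝ E] {H : Type*} [TopologicalSpace H]
  {I : ModelWithCorners ℝ E H} {M : Type*} [TopologicalSpace M] [ChartedSpace H M]
  [IsManifold I ∞ M] [FiniteDimensional ℝ E] [CompleteSpace E]
  {g : ℝ → PseudoRiemannianMetric I ∞ E (TangentSpace I : M → Type _)} {S : Set ℝ}
  {cov : ℝ → CovariantDerivative I E (TangentSpace I : M → Type _)}

/-- **The scalar curvature of a smooth family of metrics is smooth jointly in space and time.**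
Let `g` be a one-parameter family of `C^∞` pseudo-Riemannian metrics on a `C^∞` manifold `M`
(finite-dimensional complete model space), `C^∞` on `M × S` in the sense of
`IsContMDiffFamilyOn` (within `S` in time: one-sided at boundary points of `S`, e.g. at `t = 0`
for `S = [0, T)`), and `cov t`, `t ∈ S`, Levi-Civita witnesses (torsion-free, `g t`-compatible).
Then `(x, t) ↦ R(x, t) = tr_{g_t} Ric_{cov t}(x)` (`scalarCurvatureWith (g t) (cov t) x`) is
`C^∞` on `M × S` (within `univ ×ˢ S` on the product manifold `M × ℝ`). This is the convention
"`g(t)` is a smooth family of smooth metrics – smooth all the way to `t = 0` and `t = T`" under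
which all curvature quantities are smooth on space-time (Topping 2006, §1.2.3), made a theorem:
in a local frame, `R` is a rational function of the metric coefficients `g_{ij}(x, t)` and
their space derivatives up to order two (Gallot–Hulin–Lafontaine 2004, Prop. 2.54 and 3.A.3;
O'Neill 1983, Def. 3.53), all of which are jointly `C^∞`.
[cite: Topping2006, §1.2.3] [cite: ONeill1983, Ch. 3, Def. 3.53] -/
theorem IsContMDiffFamilyOn.contMDiffOn_scalarCurvatureWith (hg : IsContMDiffFamilyOn ∞ g S)
    (hLC : ∀ t ∈ S, (g t).IsLeviCivita (cov t)) :
    ContMDiffOn (I.prod 𝓘(ℝ, ℝ)) 𝓘(ℝ, ℝ) ∞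
      (fun p : M × ℝ ↦ (g p.2).scalarCurvatureWith (cov p.2) p.1) (univ ×ˢ S) := by
  intro p hp
  have hmem : p.1 ∈ (trivializationAt E (TangentSpace I : M → Type _) p.1).baseSet :=
    mem_baseSet_trivializationAt E (TangentSpace I : M → Type _) p.1
  have h := hg.contMDiffOn_scalarCurvatureWith_baseSet p.1 hLC p ⟨hmem, hp.2⟩
  refine h.mono_of_mem_nhdsWithin ?_
  have hset : (trivializationAt E (TangentSpace I : M → Type _) p.1).baseSet ×ˢ S =
      (univ ×ˢ S) ∩
        (Prod.fst ⁻¹' (trivializationAt E (TangentSpace I : M → Type _) p.1).baseSet) := by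
    ext q
    simp only [mem_prod, mem_inter_iff, mem_preimage, mem_univ, true_and, and_comm]
  rw [hset]
  exact inter_mem_nhdsWithin _ (((trivializationAt E (TangentSpace I : M → Type _)
    p.1).open_baseSet.preimage continuous_fst).mem_nhds hmem)

/-- **The scalar curvature of a smooth family of metrics is continuous jointly in space and
time** (continuity part of `contMDiffOn_scalarCurvatureWith`; Topping 2006, §1.2.3).
[cite: Topping2006, §1.2.3] -/
theorem IsContMDiffFamilyOn.continuousOn_scalarCurvatureWith (hg : IsContMDiffFamilyOn ∞ g S)
    (hLC : ∀ t ∈ S, (g t).IsLeviCivita (cov t)) :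
    ContinuousOn (fun p : M × ℝ ↦ (g p.2).scalarCurvatureWith (cov p.2) p.1) (univ ×ˢ S) :=
  (hg.contMDiffOn_scalarCurvatureWith hLC).continuousOn

end Main

universe u v w

/-- **Discharge of the named fact `continuousOn_scalarCurvatureWith_family`**
(`CanonicalNeighbourhoodTheorem.lean`; O'Neill 1983, Ch. 3, Def. 3.53 — the scalar curvature is a
smooth function — under the space-time smoothness convention of Topping 2006, §1.2.3): for a
family of `C^∞` metrics jointly `C^∞` on `M × [0, T)` with Levi-Civita witnesses, the scalar
curvature is continuous on `M × [0, T)`. By `IsContMDiffFamilyOn.continuousOn_scalarCurvatureWith`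
(indeed it is `C^∞` there, `IsContMDiffFamilyOn.contMDiffOn_scalarCurvatureWith`; the
hypothesis `I.Boundaryless` of the fact is not needed). [cite: ONeill1983, Ch. 3, Def. 3.53]
[cite: Topping2006, §1.2.3] -/
theorem continuousOn_scalarCurvatureWith_family_holds :
    continuousOn_scalarCurvatureWith_family.{u, v, w} := by
  intro E _ _ _ _ H _ I _ M _ _ _ T g cov hg hLC
  exact hg.continuousOn_scalarCurvatureWith hLC

end Literature.Geometry.Riemannian
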